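import Literature.Probability.RandomPlanarGeometry.HexSAWBrickWallPolygonPairs
import Literature.Probability.RandomPlanarGeometry.HexSAWBrickWallBridgeEnvelope
import Literature.Probability.RandomPlanarGeometry.HexSAWHammersleyWelshSix
import Literature.Probability.RandomPlanarGeometry.HexSAWTheorem1
import Mathlib.Analysis.SpecialFunctions.Pow.Real
import HarnessLib

/-!
# Self-avoiding polygons of the honeycomb lattice grow at rate `μ_ℍ = √(2+√2)` (Hammersley's theorem on `ℍ`)

Topic `Literature/Probability/RandomPlanarGeometry` (lane «pcv-sawmu», door «HEX-SAP»; closes the chain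
`HexSAWBrickWallPieces` → `…BridgeTail` → `…PolygonGlue` → `…PolygonDesigns` → `…PolygonPairs`
(`b_{2K}(ℍ)² ≤ P(K) · c_{4K+21}(0,e₀)` and `… c_{4K+23}(0,e₀)`) with the even-length bridge envelope
`e^{−9√K} μ_ℍ^{2K} ≤ μ_ℍ b_{2K}(ℍ)` (`HexSAWBrickWallBridgeEnvelope.lean`) and the Hammersley–Welsh bound
`c_n(ℍ) ≤ μ_ℍ e^{6√n} μ_ℍ^n` (`HexSAWHammersleyWelshSix.lean`)).

Sources and status in print (lit-1 gen 9 cell, 2026-08-22): J. M. Hammersley, *The number of polygons on a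
lattice*, Proc. Cambridge Philos. Soc. 57 (1961) 516–523 and N. Madras, G. Slade, *The Self-Avoiding Walk* (1993),
§3.2 (Theorem 3.2.3 p. 64, Theorem 3.2.4 p. 65 with proof pp. 65–67, Corollary 3.2.5 (3.2.9) p. 67, Notes p. 75)
prove `μ_polygon = μ_walk` for the hypercubic lattices `ℤ^d`; A. J. Guttmann (ed.), *Polygons, Polyominoes and
Polycubes*, LNP 775 (2009), Ch. 1 p. 3 ("the growth constants μ that arise in the polygon case and the walk case
are identical") and Ch. 2 (Theorem 1, §2.4) state it, resp. prove it for `ℤ^d`, and Ch. 8 §8.4.1 uses it for the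
honeycomb lattice (calling `1/(2+√2)` the "conjectured exact value" of `x_c²`); A. J. Guttmann, arXiv:1212.3448
§2.2 asserts it for periodic lattices.  No printed proof for the honeycomb lattice has been located; this file
gives one (Madras–Slade's mechanism with this lane's parity repair, brick-wall frame), and with
Duminil-Copin–Smirnov's theorem `μ_ℍ = √(2+√2)` (tree, `HexSAWTheorem1.lean`) the polygon growth constant of the
honeycomb lattice becomes the explicit algebraic number `√(2+√2)`.

## Contents (namespace `Literature.Probability.RandomPlanarGeometry.SAW`)

* `hexPolygonCount N = c_{N−1}(0, e₀)` on `ℍ` — the `(N−1)`-step honeycomb self-avoiding walks from `0` to its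
  neighbour `e₀ = (1,0)` (brick-wall frame), i.e. the `N`-step self-avoiding polygons through the bond `{0, e₀}`,
  each with its two orientations (Madras–Slade (3.2.1)); `hexPolygonCount_le` (`≤ c_{N−1}(ℍ)`),
  `hexPolygonCount_eq_zero_of_odd` (bipartite);
* **`abs_log_hexPolygonCount_sub_le`**: for even `N ≥ 26`, `0 < hexPolygonCount N` and
  `|log hexPolygonCount N − N log μ_ℍ| ≤ (32 + 26 log μ_ℍ) √N`;
* **`tendsto_hexPolygonCount_rpow`**: `(hexPolygonCount (2K))^{1/(2K)} → μ_ℍ`, and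
  **`tendsto_hexPolygonCount_rpow_sqrt`**: `… → √(2+√2)` (`μ_polygon(ℍ) = μ_ℍ = √(2+√2)`).
-/

noncomputable section

open Real Filter Topology Finset
open Literature.Probability.LatticeModels Literature.Probability.Percolation

namespace Literature.Probability.RandomPlanarGeometry.SAW

/-- **Rooted polygons of `ℍ` through a fixed bond**: `hexPolygonCount N = c_{N−1}(0,e₀)`, the number of
`(N−1)`-step honeycomb self-avoiding walks from `0` to its horizontal neighbour `e₀ = (1,0)` (brick-wall frame) —
closed up by the bond `{e₀, 0}`, the `N`-step self-avoiding polygons containing that bond, oriented ("`2N q_N` is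
the number of `(N−1)`-step self-avoiding walks with `ω(N−1)` adjacent to `ω(0)`", here for one of the three
neighbours). [cite: MadrasSlade1993, Definition 3.2.2 and eq. (3.2.1), p. 63] -/
def hexPolygonCount (N : ℕ) : ℕ := HexBW.endAtCount (N - 1) (Pi.single 0 1)

/-- `hexPolygonCount N ≤ c_{N−1}(ℍ)` (a polygon minus one bond is a walk). [cite: MadrasSlade1993, eq. (3.2.1) and (3.2.5)] -/
theorem hexPolygonCount_le (N : ℕ) : hexPolygonCount N ≤ hexSawCount (N - 1) :=
  HexBW.endAtCount_le _ _

/-- **No odd polygons**: the honeycomb lattice is bipartite (after `n` steps a brick-wall walk sits at a site of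
parity `n`, and `e₀` is odd). [cite: Whittington2009LatticePolygons, §2.2 (hypercubic lattices: "there are no polygons with an odd number of edges"; same parity mechanism on the bipartite honeycomb)] -/
theorem hexPolygonCount_eq_zero_of_odd {N : ℕ} (hN : Odd N) : hexPolygonCount N = 0 := by
  rw [hexPolygonCount, HexBW.endAtCount, Finset.card_eq_zero, Finset.eq_empty_iff_forall_notMem]
  intro ρ hρ
  rw [HexBW.mem_endAt] at hρ
  obtain ⟨hρ, hend⟩ := hρ
  have h := HexBW.parity_apply hρ le_rfl
  rw [hend] at h
  simp only [Pi.single_eq_same, Pi.single_eq_of_ne (one_ne_zero : (1 : Fin 2) ≠ 0), add_zero] at h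
  obtain ⟨k, hk⟩ := hN
  have : (((N - 1 : ℕ) : ℤ)) % 2 = 0 := by
    have : N - 1 = 2 * k := by omega
    rw [this]; push_cast; omega
  omega

/-- `log x ≤ 2 √x` for `x > 0`. [cite: MadrasSlade1993, §3.2 (proof of Corollary 3.2.5: "the constant `C` can absorb all factors of polynomial order")] -/
private theorem log_le_two_sqrt {x : ℝ} (hx : 0 < x) : Real.log x ≤ 2 * Real.sqrt x := by
  have hs : 0 < Real.sqrt x := Real.sqrt_pos.2 hx
  have h1 : Real.log (Real.sqrt x) ≤ Real.sqrt x - 1 := Real.log_le_sub_one_of_pos hs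
  have h2 : Real.log x = 2 * Real.log (Real.sqrt x) := by
    conv_lhs => rw [← Real.mul_self_sqrt hx.le]
    rw [Real.log_mul hs.ne' hs.ne']; ring
  linarith

/-- **The (3.2.9) squeeze on `ℍ`, quantitative form.** For even `N ≥ 26`: `hexPolygonCount N > 0` and
`|log hexPolygonCount N − N log μ_ℍ| ≤ (32 + 26 log μ_ℍ) √N`.  Lower side: with `K = ⌊(N−22)/4⌋ ≥ 1`,
`N ∈ {4K+22, 4K+24}` and `(e^{−9√K} μ_ℍ^{2K}/μ_ℍ)² ≤ b_{2K}² ≤ 4(4K+13)⁴(2K+7)² · hexPolygonCount N`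
(two bridges make a polygon, both residues; even-length bridge envelope); upper side:
`hexPolygonCount N ≤ c_{N−1}(ℍ) ≤ μ_ℍ e^{6√(N−1)} μ_ℍ^{N−1}` (Hammersley–Welsh).
[cite: MadrasSlade1993, Theorem 3.2.4 p. 65, Corollary 3.2.5 (3.2.8)–(3.2.9) p. 67] [cite: Hammersley1961Polygons] -/
theorem abs_log_hexPolygonCount_sub_le {N : ℕ} (hN : 26 ≤ N) (hNe : Even N) :
    0 < (hexPolygonCount N : ℝ) ∧
      |Real.log (hexPolygonCount N) - N * Real.log hexConnectiveConstant| ≤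
        (32 + 26 * Real.log hexConnectiveConstant) * Real.sqrt N := by
  set μ := hexConnectiveConstant with hμdef
  have hμ1 : 1 ≤ μ := one_le_hexConnectiveConstant
  have hμ0 : 0 < μ := hexConnectiveConstant_pos
  have hL : 0 ≤ Real.log μ := Real.log_nonneg hμ1
  have hNr : (26 : ℝ) ≤ N := by exact_mod_cast hN
  have hs1 : 1 ≤ Real.sqrt N := by
    rw [show (1 : ℝ) = Real.sqrt 1 by simp]; exact Real.sqrt_le_sqrt (by linarith)
  have hlogN : Real.log N ≤ 2 * Real.sqrt N := log_le_two_sqrt (by linarith)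
  have hlogN0 : 0 ≤ Real.log N := Real.log_nonneg (by linarith)
  -- the index `K` of the bridge pair
  obtain ⟨K, hK, hKN⟩ : ∃ K, 1 ≤ K ∧ (N = 4 * K + 22 ∨ N = 4 * K + 24) := by
    obtain ⟨m, hm⟩ := hNe
    refine ⟨(N - 22) / 4, by omega, by omega⟩
  have hKr : 4 * (K : ℝ) + 22 ≤ N := by
    rcases hKN with h | h <;> · have : ((N : ℕ) : ℝ) = _ := congrArg Nat.cast h; push_cast at this; linarith
  have hKr' : (N : ℝ) ≤ 4 * K + 24 := by
    rcases hKN with h | h <;> · have : ((N : ℕ) : ℝ) = _ := congrArg Nat.cast h; push_cast at this; linarith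
  have hK1 : (1 : ℝ) ≤ K := by exact_mod_cast hK
  have hsK : Real.sqrt K ≤ Real.sqrt N := Real.sqrt_le_sqrt (by linarith)
  -- lower bound: `b_{2K}² ≤ P(K) · hexPolygonCount N`
  set P : ℝ := 4 * (4 * (K : ℝ) + 13) ^ 4 * (2 * K + 7) ^ 2 with hPdef
  have hpair : (HexBW.bridgeCount (2 * K) : ℝ) ^ 2 ≤ P * hexPolygonCount N := by
    obtain ⟨h1, h2⟩ := HexBW.sq_bridgeCount_le_mul_endAtCount hK
    rcases hKN with h | h
    · have e : N - 1 = 4 * K + 21 := by omega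
      rw [hexPolygonCount, e]; rw [hPdef]; exact_mod_cast h1
    · have e : N - 1 = 4 * K + 23 := by omega
      rw [hexPolygonCount, e]; rw [hPdef]; exact_mod_cast h2
  -- the bridge envelope `e^{-9√K} μ^{2K} ≤ μ b_{2K}`
  have hb := HexBW.exp_neg_mul_sqrt_mul_pow_le_bridgeCount K hK
  rw [← hμdef] at hb
  have hB0 : 0 < Real.exp (-(9 * Real.sqrt K)) * μ ^ (2 * K) := by positivity
  have hb' : Real.exp (-(9 * Real.sqrt K)) * μ ^ (2 * K) / μ ≤ HexBW.bridgeCount (2 * K) := by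
    rw [div_le_iff₀ hμ0]; linarith
  have hB0' : 0 < Real.exp (-(9 * Real.sqrt K)) * μ ^ (2 * K) / μ := by positivity
  have hlow : (Real.exp (-(9 * Real.sqrt K)) * μ ^ (2 * K) / μ) ^ 2 ≤ P * hexPolygonCount N :=
    (pow_le_pow_left₀ hB0'.le hb' 2).trans hpair
  have hP0 : 0 < P := by positivity
  have hPN : P ≤ (N : ℝ) ^ 7 := by
    have h1 : 4 * (K : ℝ) + 13 ≤ N := by linarith
    have h2 : 2 * (K : ℝ) + 7 ≤ N := by linarith
    have h3 : (4 : ℝ) ≤ N := by linarith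
    calc P = 4 * (4 * (K : ℝ) + 13) ^ 4 * (2 * K + 7) ^ 2 := hPdef
      _ ≤ (N : ℝ) * N ^ 4 * N ^ 2 := by
          refine mul_le_mul (mul_le_mul h3 (pow_le_pow_left₀ (by positivity) h1 4) (by positivity)
            (by positivity)) (pow_le_pow_left₀ (by positivity) h2 2) (by positivity) (by positivity)
      _ = (N : ℝ) ^ 7 := by ring
  have ht0 : 0 < (hexPolygonCount N : ℝ) := by
    by_contra h
    have h' : (hexPolygonCount N : ℝ) ≤ 0 := not_lt.1 h
    have : (Real.exp (-(9 * Real.sqrt K)) * μ ^ (2 * K) / μ) ^ 2 ≤ 0 := hlow.trans (by nlinarith)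
    exact absurd this (not_le.2 (by positivity))
  refine ⟨ht0, abs_le.2 ⟨?_, ?_⟩⟩
  · -- lower: `log t ≥ 2 (2K log μ − 9√K − log μ) − log P ≥ N log μ − 26 log μ − 18 √N − 14 √N`
    have h1 : Real.log ((Real.exp (-(9 * Real.sqrt K)) * μ ^ (2 * K) / μ) ^ 2) ≤
        Real.log (P * hexPolygonCount N) := Real.log_le_log (by positivity) hlow
    rw [Real.log_pow, Real.log_div (by positivity) hμ0.ne', Real.log_mul (Real.exp_pos _).ne' (pow_pos hμ0 _).ne',
      Real.log_exp, Real.log_pow, Real.log_mul hP0.ne' ht0.ne'] at h1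
    have hlogP : Real.log P ≤ 7 * Real.log N := by
      have := Real.log_le_log hP0 hPN
      rwa [Real.log_pow] at this
    push_cast at h1
    have hKlog : (N : ℝ) * Real.log μ ≤ (4 * K + 24) * Real.log μ := mul_le_mul_of_nonneg_right hKr' hL
    nlinarith [hsK, hlogN, hs1, hL, Real.sqrt_nonneg (K : ℝ), hlogP, hKlog]
  · -- upper: `t ≤ c_{N-1} ≤ μ e^{6√(N-1)} μ^{N-1} = e^{6√(N−1)} μ^N ≤ e^{6√N} μ^N`
    have hup : (hexPolygonCount N : ℝ) ≤ Real.exp (6 * Real.sqrt N) * μ ^ N := by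
      have h1 : (hexPolygonCount N : ℝ) ≤ hexSawCount (N - 1) := by exact_mod_cast hexPolygonCount_le N
      refine h1.trans ((HexBW.hexSawCount_le_mu_mul_exp_mul_pow (N - 1)).trans ?_)
      rw [← hμdef]
      have hs : Real.sqrt ((N - 1 : ℕ) : ℝ) ≤ Real.sqrt N :=
        Real.sqrt_le_sqrt (by exact_mod_cast Nat.sub_le N 1)
      have hpow : μ * μ ^ (N - 1) = μ ^ N := by
        rw [← pow_succ']; congr 1; omega
      calc μ * Real.exp (6 * Real.sqrt ((N - 1 : ℕ) : ℝ)) * μ ^ (N - 1)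
          = Real.exp (6 * Real.sqrt ((N - 1 : ℕ) : ℝ)) * (μ * μ ^ (N - 1)) := by ring
        _ ≤ Real.exp (6 * Real.sqrt N) * μ ^ N := by
          rw [hpow]
          exact mul_le_mul_of_nonneg_right (Real.exp_le_exp.2 (by linarith)) (pow_nonneg hμ0.le _)
    have h2 : Real.log (hexPolygonCount N) ≤ Real.log (Real.exp (6 * Real.sqrt N) * μ ^ N) :=
      Real.log_le_log ht0 hup
    rw [Real.log_mul (Real.exp_pos _).ne' (pow_pos hμ0 _).ne', Real.log_exp, Real.log_pow] at h2
    nlinarith [hs1, hL]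

/-- `log (hexPolygonCount (2K)) / (2K) → log μ_ℍ`: the polygon and walk connective constants of `ℍ` coincide
(logarithmic form, along the even lengths). [cite: MadrasSlade1993, §3.2 Cor. 3.2.5 (3.2.9) p. 67] [cite: Hammersley1961Polygons] -/
theorem tendsto_log_hexPolygonCount_div :
    Tendsto (fun K : ℕ => Real.log (hexPolygonCount (2 * K)) / (2 * K : ℕ)) atTop
      (𝓝 (Real.log hexConnectiveConstant)) := by
  set L := Real.log hexConnectiveConstant with hLdef
  set C := 32 + 26 * L with hC
  have h2K : Tendsto (fun K : ℕ => ((2 * K : ℕ) : ℝ)) atTop atTop :=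
    tendsto_natCast_atTop_atTop.comp (tendsto_id.const_mul_atTop' (by norm_num : 0 < 2))
  have herr : Tendsto (fun K : ℕ => C / Real.sqrt ((2 * K : ℕ) : ℝ)) atTop (𝓝 0) :=
    tendsto_const_nhds.div_atTop (Real.tendsto_sqrt_atTop.comp h2K)
  have hlo : Tendsto (fun K : ℕ => L - C / Real.sqrt ((2 * K : ℕ) : ℝ)) atTop (𝓝 L) := by
    simpa using (tendsto_const_nhds (x := L)).sub herr
  have hhi : Tendsto (fun K : ℕ => L + C / Real.sqrt ((2 * K : ℕ) : ℝ)) atTop (𝓝 L) := by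
    simpa using (tendsto_const_nhds (x := L)).add herr
  refine tendsto_of_tendsto_of_tendsto_of_le_of_le' hlo hhi ?_ ?_
  · filter_upwards [eventually_ge_atTop 13] with K hK
    obtain ⟨ht0, hb⟩ := abs_log_hexPolygonCount_sub_le (N := 2 * K) (by omega) ⟨K, by ring⟩
    rw [← hLdef, ← hC] at hb
    have hN0 : (0 : ℝ) < ((2 * K : ℕ) : ℝ) := by exact_mod_cast (by omega : 0 < 2 * K)
    have hs0 : 0 < Real.sqrt ((2 * K : ℕ) : ℝ) := Real.sqrt_pos.2 hN0
    have h1 := (abs_le.1 hb).1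
    rw [le_div_iff₀ hN0]
    have e : (L - C / Real.sqrt ((2 * K : ℕ) : ℝ)) * ((2 * K : ℕ) : ℝ) =
        ((2 * K : ℕ) : ℝ) * L - C * Real.sqrt ((2 * K : ℕ) : ℝ) := by
      have : (((2 * K : ℕ) : ℝ)) = Real.sqrt ((2 * K : ℕ) : ℝ) * Real.sqrt ((2 * K : ℕ) : ℝ) :=
        (Real.mul_self_sqrt hN0.le).symm
      field_simp
      linear_combination (-C) * this
    linarith [e]
  · filter_upwards [eventually_ge_atTop 13] with K hK
    obtain ⟨ht0, hb⟩ := abs_log_hexPolygonCount_sub_le (N := 2 * K) (by omega) ⟨K, by ring⟩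
    rw [← hLdef, ← hC] at hb
    have hN0 : (0 : ℝ) < ((2 * K : ℕ) : ℝ) := by exact_mod_cast (by omega : 0 < 2 * K)
    have hs0 : 0 < Real.sqrt ((2 * K : ℕ) : ℝ) := Real.sqrt_pos.2 hN0
    have h1 := (abs_le.1 hb).2
    rw [div_le_iff₀ hN0]
    have e : (L + C / Real.sqrt ((2 * K : ℕ) : ℝ)) * ((2 * K : ℕ) : ℝ) =
        ((2 * K : ℕ) : ℝ) * L + C * Real.sqrt ((2 * K : ℕ) : ℝ) := by
      have : (((2 * K : ℕ) : ℝ)) = Real.sqrt ((2 * K : ℕ) : ℝ) * Real.sqrt ((2 * K : ℕ) : ℝ) :=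
        (Real.mul_self_sqrt hN0.le).symm
      field_simp
      linear_combination C * this
    linarith [e]

/-- **Hammersley's theorem on the honeycomb lattice: `μ_polygon(ℍ) = μ_ℍ`.** Along the even lengths (the odd
counts vanish), `(hexPolygonCount (2K))^{1/(2K)} → μ_ℍ`. [cite: MadrasSlade1993, §3.2 Cor. 3.2.5 (3.2.9) p. 67 (ℤ^d)]
[cite: Hammersley1961Polygons] [cite: Guttmann2009PolygonHistory, p. 3] [cite: Whittington2009LatticePolygons, Theorem 1 (§2.3) and §2.4]
[cite: GuttmannJensen2009SeriesAnalysis, §8.4.1] [cite: Guttmann2012SAWOverview, §2.2] -/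
theorem tendsto_hexPolygonCount_rpow :
    Tendsto (fun K : ℕ => (hexPolygonCount (2 * K) : ℝ) ^ (1 / ((2 * K : ℕ) : ℝ))) atTop
      (𝓝 hexConnectiveConstant) := by
  have hexp := (Real.continuous_exp.tendsto _).comp tendsto_log_hexPolygonCount_div
  rw [Real.exp_log hexConnectiveConstant_pos] at hexp
  refine hexp.congr' ?_
  filter_upwards [eventually_ge_atTop 13] with K hK
  obtain ⟨ht0, -⟩ := abs_log_hexPolygonCount_sub_le (N := 2 * K) (by omega) ⟨K, by ring⟩
  simp only [Function.comp]
  rw [Real.rpow_def_of_pos ht0, mul_one_div]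

/-- **`μ_polygon(ℍ) = √(2+√2)`**: with Duminil-Copin–Smirnov's theorem (tree, `HexSAWTheorem1.lean`) the polygon
growth constant of the honeycomb lattice is the explicit algebraic number `√(2+√2)`:
`(hexPolygonCount (2K))^{1/(2K)} → √(2+√2)`. [cite: DuminilCopinSmirnov2012, Theorem 1] [cite: MadrasSlade1993, §3.2 Cor. 3.2.5 (3.2.9)]
[cite: GuttmannJensen2009SeriesAnalysis, §8.4.1 ("the conjectured [19, 20] exact values x_c² = 1/μ² = 1/(2+√2)")] -/
theorem tendsto_hexPolygonCount_rpow_sqrt :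
    Tendsto (fun K : ℕ => (hexPolygonCount (2 * K) : ℝ) ^ (1 / ((2 * K : ℕ) : ℝ))) atTop
      (𝓝 (Real.sqrt (2 + Real.sqrt 2))) := by
  rw [← hexConnectiveConstant_eq_of_thm1 DuminilCopinSmirnov2012_thm1_holds]
  exact tendsto_hexPolygonCount_rpow

end Literature.Probability.RandomPlanarGeometry.SAW
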